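import Mathlib
import Literature.AlgebraicGeometry.Tropical.TorusCycles
import Summits.HodgeConjecture.HodgeConjecture.Theses.TropicalWeilObstruction
import Summits.HodgeConjecture.HodgeConjecture.Theorems.TropicalWeilObstructionGenericWeilPeriod
import Summits.HodgeConjecture.HodgeConjecture.Theorems.TropicalWeilObstructionTropicalWeilVanishingOfNonflatObstructed
import Summits.HodgeConjecture.HodgeConjecture.Theorems.TropicalWeilObstructionTropicalWeilVanishingRealisationSystem
import HarnessLib

/-!
# Crux `TropicalWeilVanishing` (stmt-HodgeConjecture-18478): K1 ⟺ OBSTRUCTION AT THE IDENTITY —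
# the thesis of line `identity_transfer`, as a theorem of the tree

Route `TropicalWeilObstruction` of `HodgeConjecture`. With the registered stubs
`stub_rung_flatObstructed` (`…FlatObstructed`) and `stub_transportToIdentity` (`…TransportToIdentity`)
landed, the crux K1 = `Theses.TropicalWeilObstruction.TropicalWeilVanishing` is here reduced to — and
shown EQUIVALENT to — a statement about the single rational torus `ℝ⁸/ℤ⁸`
(`tropicalWeilVanishing_iff_obstructedAtIdentity`):

  K1 ⟺ every effective tropical `4`-cycle `Z₀` on `ℝ⁸/ℤ⁸` with `W(Z₀) ≠ 0` is OBSTRUCTED AT THE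
  IDENTITY (some linear functional on `8 × 8` matrices, non-zero on `Sym_J`, kills every symmetric
  `J`-commuting period over which the combinatorial type of `Z₀` realises).

Ingredients: the realisation system, the DICHOTOMY `obstructed_or_linearSection` and `linearSpread` of
file `…RealisationSystem`; (`exists_weilGeneric_mem_of_open`) Weil-generic positive definite periods accumulate at `1`
(segment from `1` to the tree's `GenericWeilPeriod` witness, rational parameter:
`algebraicIndependent_affine`); (`tropicalWeilVanishing_false_of_unobstructedSeed`) an UNOBSTRUCTED
seed — `Z₀` over `1` with `W ≠ 0` whose type realises linearly over `Sym_J`, a finitely checkable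
certificate — refutes K1; and the converse direction is `tropicalWeilVanishing_of_nonflatObstructed`.

Mathlib + sibling files; no definition, no named fact, no sorry.

## References

* [Zharkov2020TropicalWeil] I. Zharkov, Tropical abelian varieties, Weil classes and the Hodge
  conjecture, arXiv:2002.02347 (2020), §1–2 (pp. 2–4).
* [MikhalkinZharkov2014Eigenwave] G. Mikhalkin, I. Zharkov, Tropical eigenwave and intermediate
  Jacobians, LN UMI 15 (2014), Def. 4.2, Prop. 4.3.
-/

-- `Summit.HodgeConjecture.HodgeConjecture.…` is the mandated namespace (single-conjunct summit).
set_option linter.dupNamespace false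

noncomputable section

open scoped BigOperators Matrix Topology
open Matrix Literature.AlgebraicGeometry.Tropical

namespace Summit.HodgeConjecture.HodgeConjecture.Theorems.TropicalWeilVanishing

/-! ### Weil-generic positive definite periods accumulate at the identity -/

/-- **Weil-generic periods near `1`.** Every open set of `8 × 8` real matrices containing `1` contains
a positive definite `Q` commuting with `J = weilJ 4` whose free coordinates are algebraically
independent over `ℚ` (the segment from `1` to the tree's `GenericWeilPeriod` witness, at a small
rational parameter: rational affine substitutions preserve algebraic independence).
[cite: Zharkov2020TropicalWeil, §2 (pp. 2–4)] -/
theorem exists_weilGeneric_mem_of_open (U : Set (Matrix (Fin (2 * 4)) (Fin (2 * 4)) ℝ))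
    (hU : IsOpen U) (h1 : (1 : Matrix (Fin (2 * 4)) (Fin (2 * 4)) ℝ) ∈ U) :
    ∃ Q ∈ U, Q.PosDef ∧ Q * weilJ 4 = weilJ 4 * Q ∧ IsWeilGeneric 4 Q := by
  obtain ⟨Q₁, hQ₁, hQ₁J, hgen⟩ := tropicalWeilObstruction_genericWeilPeriod_proof
  -- the segment `t ↦ 1 + t (Q₁ - 1)` is continuous and starts in `U`
  have hcont : Continuous fun t : ℝ => (1 : Matrix (Fin (2 * 4)) (Fin (2 * 4)) ℝ) + t • (Q₁ - 1) :=
    continuous_const.add (continuous_id.smul continuous_const)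
  have hev : ∀ᶠ t in 𝓝 (0 : ℝ), (1 : Matrix (Fin (2 * 4)) (Fin (2 * 4)) ℝ) + t • (Q₁ - 1) ∈ U := by
    apply hcont.continuousAt.eventually_mem
    apply hU.mem_nhds
    simpa using h1
  obtain ⟨δ, hδ, hball⟩ := Metric.eventually_nhds_iff.1 hev
  -- a rational parameter `0 < q < min δ 1`
  obtain ⟨q, hq0, hq1⟩ := exists_rat_btwn (lt_min hδ one_pos)
  have hq0' : (0 : ℝ) < q := hq0
  have hqδ : (q : ℝ) < δ := lt_of_lt_of_le hq1 (min_le_left _ _)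
  have hq1' : (q : ℝ) < 1 := lt_of_lt_of_le hq1 (min_le_right _ _)
  refine ⟨1 + (q : ℝ) • (Q₁ - 1), hball (by rw [Real.dist_eq, sub_zero, abs_of_pos hq0']; exact hqδ),
    ?_, ?_, ?_⟩
  · -- positive definite: `(1 - q) • 1 + q • Q₁`
    have e : (1 : Matrix (Fin (2 * 4)) (Fin (2 * 4)) ℝ) + (q : ℝ) • (Q₁ - 1) =
        (1 - (q : ℝ)) • (1 : Matrix (Fin (2 * 4)) (Fin (2 * 4)) ℝ) + (q : ℝ) • Q₁ := by
      rw [smul_sub, sub_smul, one_smul]; abel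
    rw [e]
    exact (Matrix.PosDef.one.smul (by linarith)).add_posSemidef (hQ₁.posSemidef.smul hq0'.le)
  · rw [Matrix.add_mul, Matrix.mul_add, Matrix.one_mul, Matrix.mul_one, Matrix.smul_mul,
      Matrix.mul_smul, Matrix.sub_mul, Matrix.mul_sub, Matrix.one_mul, Matrix.mul_one, hQ₁J]
  · -- the free coordinates are `q • (those of Q₁) + (1 - q) • [a = b]`
    unfold IsWeilGeneric at hgen ⊢
    have h := GenericWeilPeriod.algebraicIndependent_affine hgen (fun _ => q)
      (fun ab => if ab.1.1 = ab.1.2 then 1 - q else 0) (fun _ => by exact_mod_cast hq0.ne')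
    convert h using 1
    funext ab
    simp only [Matrix.add_apply, Matrix.smul_apply, Matrix.sub_apply, Matrix.one_apply, smul_eq_mul]
    split_ifs with hab <;> push_cast <;> ring

/-! ### An unobstructed seed refutes K1; K1 ⟺ obstruction at the identity -/

/-- **An unobstructed seed refutes K1.** If some effective tropical `4`-cycle `Z₀` on `ℝ⁸/ℤ⁸` with
`W(Z₀) ≠ 0` has its combinatorial type LINEARLY REALISABLE in every direction of `Sym_J` (for every
symmetric `J`-commuting `D`: real data with the edge equations of the type and facet identifications
with period `D` — a finite rational certificate when `Z₀` is rational), then `TropicalWeilVanishing`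
fails: the type realises, effectively and with `W ≠ 0`, over all symmetric `J`-commuting periods near
`1`, among which there are Weil-generic positive definite ones.
[cite: Zharkov2020TropicalWeil, §1–2 (pp. 2–4)] [cite: MikhalkinZharkov2014Eigenwave, Def. 4.2 and Prop. 4.3] -/
theorem tropicalWeilVanishing_false_of_unobstructedSeed
    (Z₀ : TropicalTorusCycle (2 * 4) 4 (1 : Matrix (Fin (2 * 4)) (Fin (2 * 4)) ℝ))
    (hW : weilFunctional Z₀ ≠ 0)
    (hsec : ∀ D : Matrix (Fin (2 * 4)) (Fin (2 * 4)) ℝ, D.IsSymm → D * weilJ 4 = weilJ 4 * D →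
      ∃ (v : Fin Z₀.numCells → Fin (4 + 1) → Fin (2 * 4) → ℝ)
        (T : Fin Z₀.numCells → Matrix (Fin 4) (Fin 4) ℝ)
        (r : Fin Z₀.numFacetClasses → Fin 4 → Fin (2 * 4) → ℝ),
        (∀ (σ : Fin Z₀.numCells) (j : Fin 4) (a : Fin (2 * 4)),
            v σ j.succ a - v σ 0 a = ∑ m, ((Z₀.cell σ).frame a m : ℝ) * T σ m j) ∧
        (∀ (σ : Fin Z₀.numCells) (i : Fin (4 + 1)) (j : Fin 4) (a : Fin (2 * 4)),
            v σ (i.succAbove (Z₀.facetPerm σ i j)) a =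
              r (Z₀.facetClass σ i) j a + ∑ b, D a b * (Z₀.facetShift σ i b : ℝ))) :
    ¬ Theses.TropicalWeilObstruction.TropicalWeilVanishing := by
  intro hK
  have h1S : (1 : Matrix (Fin (2 * 4)) (Fin (2 * 4)) ℝ).IsSymm := Matrix.isSymm_one
  have h1J : (1 : Matrix (Fin (2 * 4)) (Fin (2 * 4)) ℝ) * weilJ 4 = weilJ 4 * 1 := by
    rw [Matrix.one_mul, Matrix.mul_one]
  obtain ⟨V, T, Rf, hTcont, hT1, hreal⟩ := linearSpread h1S h1J Z₀ hsec
  -- the open set `U ∋ 1`: positive edge determinants and non-zero Weil expression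
  set U : Set (Matrix (Fin (2 * 4)) (Fin (2 * 4)) ℝ) := {P | (∀ σ, 0 < (T P σ).det) ∧
    (∑ σ, ((Z₀.cell σ).weight : ℂ) * (((T P σ).det / ((4 : ℕ).factorial : ℝ) : ℝ) : ℂ) *
      frameComplexDet 4 (Z₀.cell σ).frame ^ 2) ≠ 0} with hU
  have hUopen : IsOpen U := by
    have h1 : IsOpen {P : Matrix (Fin (2 * 4)) (Fin (2 * 4)) ℝ | ∀ σ, 0 < (T P σ).det} := by
      rw [Set.setOf_forall]
      exact isOpen_iInter_of_finite fun σ => isOpen_lt continuous_const (hTcont σ).matrix_det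
    have h2 : IsOpen {P : Matrix (Fin (2 * 4)) (Fin (2 * 4)) ℝ |
        (∑ σ, ((Z₀.cell σ).weight : ℂ) * (((T P σ).det / ((4 : ℕ).factorial : ℝ) : ℝ) : ℂ) *
          frameComplexDet 4 (Z₀.cell σ).frame ^ 2) ≠ 0} := by
      refine isOpen_ne_fun ?_ continuous_const
      refine continuous_finsetSum _ fun σ _ => ?_
      exact (continuous_const.mul (Complex.continuous_ofReal.comp
        ((hTcont σ).matrix_det.div_const _))).mul continuous_const
    exact h1.inter h2
  have h1U : (1 : Matrix (Fin (2 * 4)) (Fin (2 * 4)) ℝ) ∈ U := by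
    refine ⟨fun σ => by rw [hT1 σ]; exact (Z₀.cell σ).edgeCoeff_det_pos, ?_⟩
    have e : (∑ σ, ((Z₀.cell σ).weight : ℂ) * (((T 1 σ).det / ((4 : ℕ).factorial : ℝ) : ℝ) : ℂ) *
        frameComplexDet 4 (Z₀.cell σ).frame ^ 2) = weilFunctional Z₀ := by
      unfold weilFunctional TropicalCell.latticeVolume
      exact Finset.sum_congr rfl fun σ _ => by rw [hT1 σ]
    rw [e]; exact hW
  -- a Weil-generic positive definite period in `U`, and the realisation over it
  obtain ⟨Q, hQU, hQ, hQJ, hgen⟩ := exists_weilGeneric_mem_of_open U hUopen h1U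
  have hQS : Q.IsSymm := by
    have h := hQ.1
    rw [Matrix.IsHermitian, Matrix.conjTranspose_eq_transpose_of_trivial] at h
    exact h
  obtain ⟨hv, hfe⟩ := hreal Q hQS hQJ
  have h0 := hK Q hQ hQJ hgen
    { numCells := Z₀.numCells
      cell := fun σ =>
        { weight := (Z₀.cell σ).weight
          weight_pos := (Z₀.cell σ).weight_pos
          vertex := V Q σ
          frame := (Z₀.cell σ).frame
          edgeCoeff := T Q σ
          vertex_succ_sub := hv σ
          edgeCoeff_det_pos := hQU.1 σ
          frame_saturated := (Z₀.cell σ).frame_saturated }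
      numFacetClasses := Z₀.numFacetClasses
      refFacet := Rf Q
      facetClass := Z₀.facetClass
      facetPerm := Z₀.facetPerm
      facetShift := Z₀.facetShift
      facet_eq := hfe
      balanced := Z₀.balanced }
  exact hQU.2 h0

/-- **K1 ⟺ OBSTRUCTION AT THE IDENTITY** (the thesis of line `identity_transfer`, now a theorem):
`TropicalWeilVanishing` holds iff every effective tropical `4`-cycle `Z₀` on `ℝ⁸/ℤ⁸` with
`W(Z₀) ≠ 0` is obstructed at the identity — some linear functional on `8 × 8` matrices, non-zero on
`Sym_J`, vanishes at every symmetric `J`-commuting period over which the combinatorial type of `Z₀`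
realises. (`→`: dichotomy + an unobstructed seed refutes K1; `←`: `tropicalWeilVanishing_of_nonflatObstructed`.)
[cite: Zharkov2020TropicalWeil, §1–2 (pp. 2–4)] [cite: MikhalkinZharkov2014Eigenwave, Def. 4.2 and Prop. 4.3] -/
theorem tropicalWeilVanishing_iff_obstructedAtIdentity :
    Theses.TropicalWeilObstruction.TropicalWeilVanishing ↔
      ∀ Z₀ : TropicalTorusCycle (2 * 4) 4 (1 : Matrix (Fin (2 * 4)) (Fin (2 * 4)) ℝ),
        weilFunctional Z₀ ≠ 0 →
        ∃ ℓ : Matrix (Fin (2 * 4)) (Fin (2 * 4)) ℝ →ₗ[ℝ] ℝ,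
          (∃ D : Matrix (Fin (2 * 4)) (Fin (2 * 4)) ℝ, D.IsSymm ∧
            D * weilJ 4 = weilJ 4 * D ∧ ℓ D ≠ 0) ∧
          ∀ Q' : Matrix (Fin (2 * 4)) (Fin (2 * 4)) ℝ, Q'.IsSymm → Q' * weilJ 4 = weilJ 4 * Q' →
            (∃ Z' : TropicalTorusCycle (2 * 4) 4 Q',
              ∃ (hc : Z'.numCells = Z₀.numCells) (hf : Z'.numFacetClasses = Z₀.numFacetClasses),
                ∀ σ : Fin Z'.numCells,
                  (Z'.cell σ).weight = (Z₀.cell (Fin.cast hc σ)).weight ∧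
                  (Z'.cell σ).frame = (Z₀.cell (Fin.cast hc σ)).frame ∧
                  ∀ i : Fin (4 + 1),
                    Fin.cast hf (Z'.facetClass σ i) = Z₀.facetClass (Fin.cast hc σ) i ∧
                    Z'.facetPerm σ i = Z₀.facetPerm (Fin.cast hc σ) i ∧
                    Z'.facetShift σ i = Z₀.facetShift (Fin.cast hc σ) i) → ℓ Q' = 0 := by
  constructor
  · intro hK Z₀ hW
    rcases obstructed_or_linearSection Z₀ with h | h
    · exact h
    · exact absurd hK (tropicalWeilVanishing_false_of_unobstructedSeed Z₀ hW h)
  · intro h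
    exact tropicalWeilVanishing_of_nonflatObstructed fun Z₀ hW _ => h Z₀ hW

end Summit.HodgeConjecture.HodgeConjecture.Theorems.TropicalWeilVanishing

end
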